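import Summits.QuantumFields.YangMills.Theorems.UnitScaleTiltProp8FlatOpsHRowsFromKernels
import HarnessLib

/-!
# Route `UnitScaleTilt`, crux K1 child «MinimiserStabilityRegPr» (stmt-QuantumFields-19200), stub H `stub_halvingStep`, the (165)-A₁ row's dressing letter `C_E`:
# **WANTED №g26-1 (X1) — THE `∂^{η*}∂^η`-SUP ROW OF `H` IN PLAIN-SUP CURRENCY** (`w₃(b)·|(∂^{η*}∂^η HX)(b)| ≤ B·sup_c |X(c)|`)
# **FROM THE KERNEL ROW (k3) AND A PLAIN EXPONENTIAL ROW SUM ([Balaban1984PropagatorsII] Lemma 2.1 (2.61))** — and, for the record, the `w₁`-weighted row that the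
# (162) row sum `RowSum162` alone gives (★w5-19200 g3 LOCATED 04:38Z (L3): «one power of `w₁(b) = Lʲ⁽ᵇ⁾η` short»)

Cell `ym3-torus` (HUMAN RULING D-0037, YM ladder rung R3), width seat `ym-ust-19936-w3` gen 4 (★★OWNER ym3-torus-plan g26 RULING (X1) 2026-08-28T04:53:12Z).
`--supports stmt-QuantumFields-19200 --as helper`; count-neutral; def-free.  Serves item 19936 `HistoryTailL` only through its (T) row (T8 ⇐ {H, EX}).

THE PRINT.  [Balaban1985Variational] (88) p. 291 bounds the dressing gradients (85)–(89) using, for `E₁ = −½(∂*∂)_c(H·D(A′))`, a sup row of `∂^{η*}∂^ηH` against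
PLAIN-sup index data (the (55) output `|D(A′)(c)| ≤ 4C₂r²` is plain-sup: `FlatProp4Dressing.hWq_of_dressing`'s `hD`, `hH`); print gets it from [5] (3.132)
`|(QGQ*)⁻¹(b,b′)| ≤ O(1)(Lʲη)⁻²e^{−δd}` via (137) `∂*∂H = Q*((QGQ*)⁻¹ − a)`.  In the tree the kernel form is ALREADY a row of record: (k3) of
`FlatOpsHRowsFromKernels.HKernelRows` — `w₃(b)·|(∂^{η*}∂^η He_c)(b)| ≤ C·e^{−δ·d(b,c)}` for every indicator `e_c` — discharged at every `Adm22` family by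
`FlatPortKernelRowsL0.kernelRowsAt_of_adm22` (∘ `FlatPortHRows34L0.hRow3_of_portShapes` ∘ lit-balaban's `prop27_kLevel_unconditional` = [Balaban1984PropagatorsII] Prop. 2.7 (2.149)).
Summing (k3) against plain-sup data needs the PLAIN row sum `Σ_c e^{−s·d(b,c)} ≤ K₀` (Lemma 2.1 (2.61) p. 234, NO level factor) — not the (162) row sum `RowSum162`, which
carries the left weight `w₁(b)` (it absorbs the level factor `L^{j(b)−j(c)}` of level-weighted data and is what (46)∕(130) use).

WHAT IS PROVED (sorry-free; axioms standard; no definition).  For every nested family `D`, weights `w`, distance `dBI ≥ 0`, plain-function `H`: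
* §1 `sum_exp_mul_abs_le` — `Σ_c e^{−δd}|X(c)| ≤ t·Σ_c e^{−sd}` for `|X| ≤ t`, `s ≤ δ`;
  ★ **`plainRows_of_hDecayLetterD`** — the four (161)₁ rows `HDecayLetterD … dBI w H B₀ δ` + `∀ b, Σ_c e^{−s·dBI(b,c)} ≤ K₀` (`s ≤ δ`) ⟹ for plain-sup data `|X(c)| ≤ t`:
  `w₁|HX| ≤ B₀K₀t`, `w₂η⁻¹|∇HX| ≤ B₀K₀t`, **`w₃|∂*∂HX| ≤ B₀K₀t`**, `w₃η⁻²|ΔHX| ≤ B₀K₀t`;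
  ★★ **`curlCurlSupRow_of_kernelRows`** — (X1): `HKernelRows … dBI w H C δ` + the plain row sum ⟹ `∀ X t, 0 ≤ t → (∀ c, |X c| ≤ t) → ∀ b, w₃(b)·|(∂^{η*}∂^ηHX)(b)| ≤ C·K₀·t`
  (and `plainRows_of_kernelRows`, all four);
* §2 ★ **`curlCurlRowW1_of_kernelRows`** — what (162) ALONE gives: `HKernelRows … C δ` + `RowSum162 … δ₀ B₃` (`δ₀/2 ≤ δ`) ⟹ for LEVEL-weighted data `(L^{j(c)}η)|X(c)| ≤ t`:
  `w₁(b)·(w₃(b)·|(∂^{η*}∂^ηHX)(b)|) ≤ C·B₃·t` — exact on the top layer (`w₁ = 1`), one power of `w₁` short below it (the located gap, stated as a theorem so nobody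
  re-derives it hoping for more).
The plain row sum at the port distance `d_T + 3` of every charted∕`Adm22` family is the companion file `…FlatPortCurlCurlSupRowL0` (same seat).
HONEST SCOPE: finite sums and linearity; no estimate proved here; NOT a claim about the mass gap.  YM₃ on the three-torus is rung R3 of the programme, not the Clay problem.

References: T. Bałaban, CMP **102** (1985) 277–309 [Balaban1985Variational] (46) p.285, (85)–(89) pp.290–291, (137)–(140) pp.298–299, (161)–(163) p.303; CMP **96** (1984)
223–250 [Balaban1984PropagatorsII] Lemma 2.1 (2.61) p.234, Prop. 2.7 (2.149), Cor. 2.8 (2.150)–(2.151) p.249.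
-/

set_option autoImplicit false

noncomputable section

open scoped BigOperators

namespace Summit.QuantumFields.YangMills.Theorems.FlatHCurlCurlSupRow

open Literature.MathematicalPhysics.QuantumFieldTheory.Balaban1983to89
open B6SectADomainsV1 (Domains)
open B6SectAOperatorsV1 (BondIdx dcE dcsE)
open T3ContinuumYM3Torus (T3Family)
open FlatCubeOpsText (IsLevWeight HDecayLetterD RowSum162)
open FlatOpsHRowsFromKernels (HKernelRows hDecayLetterD_of_kernelRows levBase_bounds abs_data_le exp_le_rowSummand apply_eq_sum_indicator exists_indicator)

variable {F : T3Family} {n K : ℕ} {D : Domains (F.P K)} {w : ℕ → PBond (F.P K) 0 → ℝ}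
variable {dBI : PBond (F.P K) 0 → BondIdx D → ℝ} {H : (BondIdx D → ℝ) →ₗ[ℝ] (PBond (F.P K) 0 → ℝ)}

/-! ## §1 Plain-sup data: the four decaying rows summed against `Σ_c e^{−s·d(b,c)} ≤ K₀` -/

/-- for plain-sup data `|X(c)| ≤ t` and rates `s ≤ δ` over a nonnegative distance: `Σ_c e^{−δd(b,c)}|X(c)| ≤ t·Σ_c e^{−sd(b,c)}`.
[cite: Balaban1984PropagatorsII, Lemma 2.1 (2.61) p.234; Balaban1985Variational, (161) p.303] -/
theorem sum_exp_mul_abs_le {s δ t : ℝ} (hs : s ≤ δ) (hd0 : ∀ b c, 0 ≤ dBI b c) {X : BondIdx D → ℝ} (hX : ∀ c, |X c| ≤ t) (b : PBond (F.P K) 0) :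
    ∑ c, Real.exp (-(δ * dBI b c)) * |X c| ≤ t * ∑ c, Real.exp (-(s * dBI b c)) := by
  rw [Finset.mul_sum]
  refine Finset.sum_le_sum fun c _ => ?_
  have h1 : Real.exp (-(δ * dBI b c)) ≤ Real.exp (-(s * dBI b c)) :=
    Real.exp_le_exp.2 (neg_le_neg (mul_le_mul_of_nonneg_right hs (hd0 b c)))
  calc Real.exp (-(δ * dBI b c)) * |X c| ≤ Real.exp (-(s * dBI b c)) * t :=
        mul_le_mul h1 (hX c) (abs_nonneg _) (Real.exp_pos _).le
    _ = t * Real.exp (-(s * dBI b c)) := mul_comm _ _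

/-- the common last step: `B₀·Σ_c e^{−δd}|X(c)| ≤ B₀·K₀·t`. [cite: Balaban1985Variational, (161)-(162) p.303; Balaban1984PropagatorsII, (2.61) p.234] -/
theorem mul_sum_exp_mul_abs_le {B₀ K₀ s δ t : ℝ} (hB : 0 ≤ B₀) (hs : s ≤ δ) (hd0 : ∀ b c, 0 ≤ dBI b c) (ht : 0 ≤ t)
    (hsum : ∀ b, ∑ c, Real.exp (-(s * dBI b c)) ≤ K₀) {X : BondIdx D → ℝ} (hX : ∀ c, |X c| ≤ t) (b : PBond (F.P K) 0) :
    B₀ * ∑ c, Real.exp (-(δ * dBI b c)) * |X c| ≤ B₀ * K₀ * t :=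
  calc B₀ * ∑ c, Real.exp (-(δ * dBI b c)) * |X c| ≤ B₀ * (t * ∑ c, Real.exp (-(s * dBI b c))) :=
        mul_le_mul_of_nonneg_left (sum_exp_mul_abs_le hs hd0 hX b) hB
    _ ≤ B₀ * (t * K₀) := mul_le_mul_of_nonneg_left (mul_le_mul_of_nonneg_left (hsum b) ht) hB
    _ = B₀ * K₀ * t := by ring

/-- ★ **THE FOUR (161)₁ ROWS IN PLAIN-SUP CURRENCY**: `HDecayLetterD … dBI w H B₀ δ` and the plain row sum `Σ_c e^{−s·dBI(b,c)} ≤ K₀` (`s ≤ δ`, `dBI ≥ 0`, `B₀ ≥ 0`) give,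
for every `X` with `|X(c)| ≤ t` (`t ≥ 0`) and every fine bond `b`: `w₁|HX(b)|`, `w₂η⁻¹|∇^ηHX(b)|`, `w₃|(∂^{η*}∂^ηHX)(b)|`, `w₃η⁻²|(ΔHX)(b)|` all `≤ B₀·K₀·t`.
[cite: Balaban1985Variational, (161) p.303, (46) p.285, (139)-(140) p.299; Balaban1984PropagatorsII, Lemma 2.1 (2.61) p.234] -/
theorem plainRows_of_hDecayLetterD {B₀ K₀ s δ : ℝ} (hB : 0 ≤ B₀) (hs : s ≤ δ) (hd0 : ∀ b c, 0 ≤ dBI b c)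
    (hdec : HDecayLetterD F n K D dBI w H B₀ δ) (hsum : ∀ b, ∑ c, Real.exp (-(s * dBI b c)) ≤ K₀) :
    ∀ (X : BondIdx D → ℝ) (t : ℝ), 0 ≤ t → (∀ c, |X c| ≤ t) → ∀ b : PBond (F.P K) 0,
      w 1 b * |H X b| ≤ B₀ * K₀ * t ∧
      (∀ ν : Fin 3, w 2 b * (F.L : ℝ) ^ (K - n) * |H X ⟨b.src.shift ν, b.dir⟩ - H X b| ≤ B₀ * K₀ * t) ∧
      w 3 b * |(dcsE ((F.L : ℝ) ^ (K - n)) (dcE ((F.L : ℝ) ^ (K - n)) (WithLp.toLp 2 (H X)))) b| ≤ B₀ * K₀ * t ∧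
      w 3 b * ((F.L : ℝ) ^ (K - n)) ^ 2 * |∑ ν : Fin 3, ((H X b - H X ⟨b.src.shift ν, b.dir⟩) + (H X b - H X ⟨b.src.unshift ν, b.dir⟩))| ≤
        B₀ * K₀ * t := by
  intro X t ht hX b
  have hfin := mul_sum_exp_mul_abs_le hB hs hd0 ht hsum hX b
  obtain ⟨h1, h2, h3, h4⟩ := hdec X b
  exact ⟨h1.trans hfin, fun ν => (h2 ν).trans hfin, h3.trans hfin, h4.trans hfin⟩

/-- ★ **(X1) FROM THE DECAYING ROWS**: the `∂^{η*}∂^η`-sup row of `H` in plain-sup currency, `w₃(b)·|(∂^{η*}∂^ηHX)(b)| ≤ B₀·K₀·sup|X|`, from `HDecayLetterD` and the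
plain row sum. [cite: Balaban1985Variational, (88) p.291, (139)-(140) p.299, (161) p.303; Balaban1984PropagatorsII, Lemma 2.1 (2.61) p.234] -/
theorem curlCurlSupRow_of_hDecayLetterD {B₀ K₀ s δ : ℝ} (hB : 0 ≤ B₀) (hs : s ≤ δ) (hd0 : ∀ b c, 0 ≤ dBI b c)
    (hdec : HDecayLetterD F n K D dBI w H B₀ δ) (hsum : ∀ b, ∑ c, Real.exp (-(s * dBI b c)) ≤ K₀) :
    ∀ (X : BondIdx D → ℝ) (t : ℝ), 0 ≤ t → (∀ c, |X c| ≤ t) → ∀ b : PBond (F.P K) 0,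
      w 3 b * |(dcsE ((F.L : ℝ) ^ (K - n)) (dcE ((F.L : ℝ) ^ (K - n)) (WithLp.toLp 2 (H X)))) b| ≤ B₀ * K₀ * t :=
  fun X t ht hX b => (plainRows_of_hDecayLetterD hB hs hd0 hdec hsum X t ht hX b).2.2.1

/-- ★ **THE FOUR ROWS IN PLAIN-SUP CURRENCY FROM THE KERNEL ROWS** `HKernelRows … dBI w H C δ` (linearity: `hDecayLetterD_of_kernelRows`) and the plain row sum.
[cite: Balaban1984PropagatorsII, Cor. 2.8 (2.150)-(2.151) p.249, Lemma 2.1 (2.61) p.234; Balaban1985Variational, (161) p.303] -/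
theorem plainRows_of_kernelRows (hw : IsLevWeight F n K D w) {C K₀ s δ : ℝ} (hC : 0 ≤ C) (hs : s ≤ δ) (hd0 : ∀ b c, 0 ≤ dBI b c)
    (hk : HKernelRows F n K D dBI w H C δ) (hsum : ∀ b, ∑ c, Real.exp (-(s * dBI b c)) ≤ K₀) :
    ∀ (X : BondIdx D → ℝ) (t : ℝ), 0 ≤ t → (∀ c, |X c| ≤ t) → ∀ b : PBond (F.P K) 0,
      w 1 b * |H X b| ≤ C * K₀ * t ∧
      (∀ ν : Fin 3, w 2 b * (F.L : ℝ) ^ (K - n) * |H X ⟨b.src.shift ν, b.dir⟩ - H X b| ≤ C * K₀ * t) ∧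
      w 3 b * |(dcsE ((F.L : ℝ) ^ (K - n)) (dcE ((F.L : ℝ) ^ (K - n)) (WithLp.toLp 2 (H X)))) b| ≤ C * K₀ * t ∧
      w 3 b * ((F.L : ℝ) ^ (K - n)) ^ 2 * |∑ ν : Fin 3, ((H X b - H X ⟨b.src.shift ν, b.dir⟩) + (H X b - H X ⟨b.src.unshift ν, b.dir⟩))| ≤
        C * K₀ * t :=
  plainRows_of_hDecayLetterD hC hs hd0 (hDecayLetterD_of_kernelRows hw hk) hsum

/-- ★★ **(X1) — THE `∂^{η*}∂^η`-SUP ROW OF `H` AT PLAIN-SUP DATA, FROM THE KERNEL ROW (k3) AND THE PLAIN ROW SUM**: `HKernelRows … dBI w H C δ`, `Σ_c e^{−s·dBI(b,c)} ≤ K₀`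
(`s ≤ δ`, `dBI ≥ 0`, `C ≥ 0`) ⟹ `∀ X t, 0 ≤ t → (∀ c, |X c| ≤ t) → ∀ b, w₃(b)·|(∂^{η*}∂^η HX)(b)| ≤ C·K₀·t` — the shape the (iii)-supplier of the (165)-A₁ row reads for
`E₁ = −½(∂*∂)_c(H·D(A′))`. [cite: Balaban1985Variational, (88) p.291, (139)-(140) p.299, (161)-(163) p.303; Balaban1984PropagatorsII, Prop. 2.7 (2.149), Cor. 2.8 (2.151) p.249, Lemma 2.1 (2.61) p.234] -/
theorem curlCurlSupRow_of_kernelRows (hw : IsLevWeight F n K D w) {C K₀ s δ : ℝ} (hC : 0 ≤ C) (hs : s ≤ δ) (hd0 : ∀ b c, 0 ≤ dBI b c)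
    (hk : HKernelRows F n K D dBI w H C δ) (hsum : ∀ b, ∑ c, Real.exp (-(s * dBI b c)) ≤ K₀) :
    ∀ (X : BondIdx D → ℝ) (t : ℝ), 0 ≤ t → (∀ c, |X c| ≤ t) → ∀ b : PBond (F.P K) 0,
      w 3 b * |(dcsE ((F.L : ℝ) ^ (K - n)) (dcE ((F.L : ℝ) ^ (K - n)) (WithLp.toLp 2 (H X)))) b| ≤ C * K₀ * t :=
  fun X t ht hX b => (plainRows_of_kernelRows hw hC hs hd0 hk hsum X t ht hX b).2.2.1

/-! ## §2 For the record: what the (162) row sum alone gives — the `w₁`-weighted `∂^{η*}∂^η` row at level-weighted data -/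

/-- ★ **THE `w₁`-WEIGHTED `∂^{η*}∂^η` ROW FROM (k3) AND (162)** (the located content of P2's rows for this letter): with LEVEL-weighted data `(L^{j(c)}η)|X(c)| ≤ t` the kernel row
gives `w₃|∂*∂HX(b)| ≤ C·t·Σ_c e^{−δd}L^{(K−n)−j(c)}`, and `RowSum162` (rate `δ₀/2 ≤ δ`, LEFT weight `w₁(b)`) bounds `w₁(b)` times that by `C·B₃·t`:
`w₁(b)·(w₃(b)·|(∂^{η*}∂^ηHX)(b)|) ≤ C·B₃·t` — (139)–(140)'s row exactly on the top layer (`w₁ = 1`) and one power of `w₁` weaker below it.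
[cite: Balaban1985Variational, (139)-(140) p.299, (161)-(162) p.303; Balaban1984PropagatorsII, Cor. 2.8 (2.150)-(2.151) p.249] -/
theorem curlCurlRowW1_of_kernelRows (hw : IsLevWeight F n K D w) (hDk : D.k = K - n) {C δ δ₀ B₃ : ℝ} (hC : 0 ≤ C) (hδ : δ₀ / 2 ≤ δ)
    (hd0 : ∀ b c, 0 ≤ dBI b c) (hk : HKernelRows F n K D dBI w H C δ) (hrow : RowSum162 F n K D dBI w δ₀ B₃) :
    ∀ (X : BondIdx D → ℝ) (t : ℝ), 0 ≤ t → (∀ c, ((F.L : ℝ) ^ ((c.1.1 : ℕ)) * ((F.L : ℝ)⁻¹) ^ (K - n)) * |X c| ≤ t) →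
      ∀ b : PBond (F.P K) 0,
        w 1 b * (w 3 b * |(dcsE ((F.L : ℝ) ^ (K - n)) (dcE ((F.L : ℝ) ^ (K - n)) (WithLp.toLp 2 (H X)))) b|) ≤ C * B₃ * t := by
  intro X t ht hX b
  obtain ⟨hw0, -, -, -⟩ := levBase_bounds hw b
  have hXc : ∀ c, |X c| ≤ t * (F.L : ℝ) ^ ((K - n) - (c.1.1 : ℕ)) := abs_data_le hDk hX
  -- row 3 of (161)₁ over `dBI` at `(C, δ)`, by linearity from the kernel rows
  have h3 := (hDecayLetterD_of_kernelRows hw hk X b).2.2.1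
  -- the per-term bound `e^{−δd}|X c| ≤ t·(e^{−½δ₀d}(d+1)L^{(K−n)−j(c)})`
  have hterm : ∀ c, Real.exp (-(δ * dBI b c)) * |X c| ≤
      t * (Real.exp (-(δ₀ / 2 * dBI b c)) * (dBI b c + 1) * (F.L : ℝ) ^ ((K - n) - (c.1.1 : ℕ))) := by
    intro c
    calc Real.exp (-(δ * dBI b c)) * |X c|
        ≤ (Real.exp (-(δ₀ / 2 * dBI b c)) * (dBI b c + 1)) * (t * (F.L : ℝ) ^ ((K - n) - (c.1.1 : ℕ))) :=
          mul_le_mul (exp_le_rowSummand hδ (hd0 b c)) (hXc c) (abs_nonneg _) (by have := hd0 b c; positivity)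
      _ = t * (Real.exp (-(δ₀ / 2 * dBI b c)) * (dBI b c + 1) * (F.L : ℝ) ^ ((K - n) - (c.1.1 : ℕ))) := by ring
  calc w 1 b * (w 3 b * |(dcsE ((F.L : ℝ) ^ (K - n)) (dcE ((F.L : ℝ) ^ (K - n)) (WithLp.toLp 2 (H X)))) b|)
      ≤ w 1 b * (C * ∑ c, Real.exp (-(δ * dBI b c)) * |X c|) := mul_le_mul_of_nonneg_left h3 hw0
    _ ≤ w 1 b * (C * ∑ c, t * (Real.exp (-(δ₀ / 2 * dBI b c)) * (dBI b c + 1) * (F.L : ℝ) ^ ((K - n) - (c.1.1 : ℕ)))) :=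
        mul_le_mul_of_nonneg_left (mul_le_mul_of_nonneg_left (Finset.sum_le_sum fun c _ => hterm c) hC) hw0
    _ = C * t * (w 1 b * ∑ c, Real.exp (-(δ₀ / 2 * dBI b c)) * (dBI b c + 1) * (F.L : ℝ) ^ ((K - n) - (c.1.1 : ℕ))) := by
        rw [← Finset.mul_sum]; ring
    _ ≤ C * t * B₃ := mul_le_mul_of_nonneg_left (hrow b) (mul_nonneg hC ht)
    _ = C * B₃ * t := by ring

end Summit.QuantumFields.YangMills.Theorems.FlatHCurlCurlSupRow

end
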